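import Literature.AlgebraicGeometry.Resolution.CurveCentreNearPointDimension
import Literature.RingTheory.RegularLocalRing.QuotientDVR
import HarnessLib

/-!
# The chart of a blowing up at an origin prime: the kernel of a map to a field is a tail of the
# regular system of parameters `(q_j, q_i/q_j, w)`

Topic: `Literature/AlgebraicGeometry/Resolution`. Ring-level lemmas behind the transversality of
strict transforms of curves under the blowing up of a regular centre ([CoP1] = Cossart–Piltant,
J. Algebra 320 (2008), Prop. 4.4, proof p. 10: "the strict transform of `Σ` in `X′` is transverse
to the exceptional divisor"; Lemma 4.3 (4): "`x′ := (y₁′ = y₁, y₂′ = y₂/y₁, y₃)`"), for a centre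
`(q) = (q_0, …, q_m)` of ANY length that is part of a regular system of parameters `(q, w)` of the
regular local ring `R` (de Jong 1996, 2.4 / Stacks 0BIQ: at an origin prime `𝔴` of the chart
`B_j = R[(q)/q_j]` the local ring `L = (B_j)_𝔴` has the regular parameters `(q_j, q_i/q_j, w)`,
tree `isRsopPart_chartFamily_reesChart`). All PROVED, no definitions, no named facts:

* `isRsopPart_shiftRsop` — shearing `q_i ↦ q_i − a_i q_j` (`i ≠ j`) preserves "part of a regular
  system of parameters" (general form of the tree's `IsRsopPart.shiftRsop`);
* `exists_span_singleton_eq_maximalIdeal_of_span_range_eq` — in a discrete valuation ring a family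
  generating `𝔪` has a member generating `𝔪`;
* `exists_isRsopPart_span_eq_ker_of_origin` — **for a ring map `θ : L → K` to a field killing the
  `q_i/q_j` (`i ≠ j`) and the `w_k` but not `q_j`, `ker θ` is generated by the tail
  `(q_i/q_j, w_k)` of the regular system of parameters of `L` — a part of a regular system of
  parameters of length `m + l` — and `ker θ + (q_j) = 𝔪_L`.** (Used with `θ` = evaluation at the
  generic point of the strict transform of a curve transverse to the centre: its ideal at the
  origin of the chart is `(q_i/q_j, w)`, transverse to the exceptional divisor `(q_j)`.)

Cell res-hironaka, F-71 brick T2c (chart route; the scheme-level statement is p-8a's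
`StrictTransformTransverseCurve.lean`).

## Sources

* V. Cossart, O. Piltant, J. Algebra 320 (2008) 1051–1082, Lemma 4.3 (4) and proof of Prop. 4.4,
  p. 10. [CossartPiltant2008]
* A. J. de Jong, Publ. Math. IHÉS 83 (1996), 2.4. [DeJong1996]
* The Stacks Project, Tag 0BIQ. [StacksProject]
* H. Matsumura, *Commutative Ring Theory* (1986), Thms. 11.2, 14.2. [Matsumura1987]
-/

noncomputable section

open IsLocalRing

namespace Literature.AlgebraicGeometry.Resolution

universe u

variable {R : Type u} [CommRing R]

/-! ## Shears -/

/-- Shearing every member `c_i`, `i ≠ j`, of a part of a regular system of parameters by a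
multiple of `c_j` gives again a part of a regular system of parameters (it generates the same
ideal; general form of `IsRsopPart.shiftRsop`). [cite: Matsumura1987, Thm. 14.2] -/
theorem isRsopPart_shiftRsop [IsLocalRing R] {d : ℕ} {c : Fin d → R} (hc : IsRsopPart c)
    (j : Fin d) (a : {i : Fin d // i ≠ j} → R) : IsRsopPart (shiftRsop c j a) := by
  obtain ⟨hR, e, y, hdim, hsp⟩ := hc
  refine ⟨hR, e, y, hdim, ?_⟩
  rw [Ideal.span_union] at hsp ⊢
  rw [span_range_shiftRsop]
  exact hsp

/-! ## Uniformizers among generators -/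

/-- In a discrete valuation ring, a family generating the maximal ideal has a member generating
it (the member that is not in `𝔪²` is a uniformizer; Matsumura Thm. 11.2: in a DVR every element
of `𝔪 ∖ 𝔪²` generates `𝔪`). [cite: Matsumura1987, Thm. 11.2] -/
theorem exists_span_singleton_eq_maximalIdeal_of_span_range_eq {D : Type*} [CommRing D]
    [IsDomain D] [IsDiscreteValuationRing D] {ι : Type*} (f : ι → D)
    (hf : Ideal.span (Set.range f) = maximalIdeal D) : ∃ i, Ideal.span {f i} = maximalIdeal D := by
  obtain ⟨ϖ, hϖ⟩ := IsDiscreteValuationRing.exists_irreducible D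
  have hm : maximalIdeal D = Ideal.span {ϖ} := hϖ.maximalIdeal_eq
  by_contra hne
  push Not at hne
  -- every `f i` lies in `𝔪²`
  have hsq : ∀ i, f i ∈ Ideal.span {ϖ ^ 2} := by
    intro i
    have hi : f i ∈ Ideal.span {ϖ} := by
      rw [← hm, ← hf]
      exact Ideal.subset_span ⟨i, rfl⟩
    obtain ⟨s, hs⟩ := Ideal.mem_span_singleton'.mp hi
    by_cases hsu : IsUnit s
    · exfalso
      apply hne i
      rw [← hs, hm]
      exact Ideal.span_singleton_mul_left_unit hsu ϖ
    · have hs' : s ∈ Ideal.span {ϖ} := by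
        rw [← hm]
        exact hsu
      obtain ⟨s', hs''⟩ := Ideal.mem_span_singleton'.mp hs'
      rw [← hs, ← hs'']
      exact Ideal.mem_span_singleton'.mpr ⟨s', by ring⟩
  have hle : maximalIdeal D ≤ Ideal.span {ϖ ^ 2} := by
    rw [← hf, Ideal.span_le]
    rintro _ ⟨i, rfl⟩
    exact hsq i
  have hϖ2 : ϖ ∈ Ideal.span {ϖ ^ 2} := hle (hm ▸ Ideal.mem_span_singleton_self ϖ)
  obtain ⟨r, hr⟩ := Ideal.mem_span_singleton'.mp hϖ2
  have h0 : ϖ * (1 - r * ϖ) = 0 := by linear_combination (-1 : D) * hr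
  have hu : IsUnit (1 - r * ϖ) := by
    apply IsLocalRing.isUnit_one_sub_self_of_mem_nonunits
    rw [← IsLocalRing.mem_maximalIdeal, hm]
    exact Ideal.mem_span_singleton'.mpr ⟨r, rfl⟩
  rcases mul_eq_zero.mp h0 with h | h
  · exact hϖ.ne_zero h
  · exact hu.ne_zero h

/-! ## The kernel at an origin prime -/

/-- **The chart family at an origin prime, read against a map to a field.** Let `R` be a regular
local ring with regular system of parameters `(q, w)` (`q` of length `m + 1`), `B_j` the chart
ring of the blowing up of `Spec R` along `(q)` at the generator `q_j`, `𝔴 ⊂ B_j` a prime over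
`𝔪_R` at which all `e_i = q_i/q_j` (`i ≠ j`) vanish (an ORIGIN prime), `L = (B_j)_𝔴`, and
`θ : L → K` a ring map to a field killing the `e_i` (`i ≠ j`) and the `w_k` but not `q_j`. Then
`ker θ = (e_i, w_k)` is generated by the `m + l` last members of the regular system of parameters
`(q_j, e_i, w_k)` of `L` (`isRsopPart_chartFamily_reesChart`), and `ker θ + (q_j) = 𝔪_L`.
(The full family generates `𝔪_L` because `dim L ≤ dim R`; the tail generates a prime with
one-dimensional quotient, contained in the prime `ker θ ≠ 𝔪_L`.) This is the local algebra of [CoP1] Lemma 4.3 (4) /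
Prop. 4.4 p. 10 at the point of the strict transform of a transverse curve (`θ` = evaluation at
its generic point). [cite: DeJong1996, 2.4] [cite: StacksProject, Tag 0BIQ]
[cite: CossartPiltant2008, Prop. 4.4 (proof, p. 10)] -/
theorem exists_isRsopPart_span_eq_ker_of_origin [IsRegularLocalRing R]
    {m : ℕ} (q : Fin (m + 1) → R) (j : Fin (m + 1)) {l : ℕ} (w : Fin l → R)
    (hz : Ideal.span (Set.range (Fin.append q w)) = maximalIdeal R)
    (hd : (maximalIdeal R).spanFinrank = (m + 1) + l)
    (𝔴 : Ideal (chartRing q j)) [𝔴.IsPrime] (h𝔴 : 𝔴.comap (chartBase q j) = maximalIdeal R)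
    (he : ∀ i : Fin (m + 1), i ≠ j → chartGen q j i ∈ 𝔴)
    (L : Type u) [CommRing L] [IsLocalRing L] [Algebra (chartRing q j) L]
    [IsLocalization.AtPrime L 𝔴] {K : Type*} [Field K] (θ : L →+* K)
    (hθe : ∀ i, i ≠ j → θ ((algebraMap (chartRing q j) L : chartRing q j →+* L) (chartGen q j i)) = 0)
    (hθw : ∀ k, θ ((algebraMap (chartRing q j) L : chartRing q j →+* L) (chartBase q j (w k))) = 0)
    (hθj : θ ((algebraMap (chartRing q j) L : chartRing q j →+* L) (chartBase q j (q j))) ≠ 0) :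
    ∃ c : Fin (m + l) → L, IsRsopPart c ∧ Ideal.span (Set.range c) = RingHom.ker θ ∧
      RingHom.ker θ ⊔ Ideal.span {(algebraMap (chartRing q j) L : chartRing q j →+* L) (chartBase q j (q j))} = maximalIdeal L := by
  classical
  -- enumeration of the indices `≠ j`
  let jJ : Fin m → {i : Fin (m + 1) // i ≠ j} := fun k => ⟨j.succAbove k, Fin.succAbove_ne j k⟩
  have hjJ : Function.Injective jJ := fun a b h =>
    Fin.succAbove_right_injective (congrArg Subtype.val h)
  have hfam := isRsopPart_chartFamily_reesChart q j w hz hd 𝔴 h𝔴 L jJ hjJ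
    (fun k => he _ (Fin.succAbove_ne j k))
  set F := chartFamily q j w L (chartBase q j) (chartGen q j) jJ with hF
  haveI hLreg : IsRegularLocalRing L := hfam.isRegularLocalRing
  -- the chart family is a full regular system of parameters: `e' = 0`
  obtain ⟨e', y, hdimL, hy, hyF⟩ := hfam.exists_rsop
  haveI := isDomain_of_isRegularLocalRing R
  have hdimle : ringKrullDim L ≤ ringKrullDim R :=
    ringKrullDim_localization_chartRing_le q j 𝔴 h𝔴 L
  have hR : ((maximalIdeal R).spanFinrank : WithBot ℕ∞) = ringKrullDim R :=
    IsRegularLocalRing.spanFinrank_maximalIdeal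
  have hL : ((maximalIdeal L).spanFinrank : WithBot ℕ∞) = ringKrullDim L :=
    IsRegularLocalRing.spanFinrank_maximalIdeal
  have he0 : e' = 0 := by
    rw [← hR, ← hL, hd, hdimL] at hdimle
    have : m + l + 1 + e' ≤ m + 1 + l := by exact_mod_cast hdimle
    omega
  subst he0
  have hspanF : Ideal.span (Set.range F) = maximalIdeal L := by
    have hrange : Set.range y = Set.range F := by
      ext z
      constructor
      · rintro ⟨i, rfl⟩
        exact ⟨i, by rw [← hyF i]; rfl⟩
      · rintro ⟨i, rfl⟩
        exact ⟨Fin.castAdd 0 i, hyF i⟩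
    rw [← hrange, hy]
  -- the tail of the chart family
  let t : Fin (m + l) → L := F ∘ Fin.succ
  have ht : IsRsopPart t := hfam.comp Fin.succ (Fin.succ_injective _)
  have hF0 : F 0 = (algebraMap (chartRing q j) L : chartRing q j →+* L) (chartBase q j (q j)) := by
    simp only [hF, chartFamily, Fin.cons_zero]
  have hFs : ∀ k, F (Fin.succ k) = Fin.append (fun k => (algebraMap (chartRing q j) L : chartRing q j →+* L) (chartGen q j (jJ k).1))
      (fun k => (algebraMap (chartRing q j) L : chartRing q j →+* L) (chartBase q j (w k))) k := by
    intro k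
    simp only [hF, chartFamily, Fin.cons_succ]
  have htθ : ∀ k, θ (t k) = 0 := by
    intro k
    change θ (F (Fin.succ k)) = 0
    rw [hFs]
    refine Fin.addCases (fun k' => ?_) (fun k' => ?_) k
    · rw [Fin.append_left]
      exact hθe _ (Fin.succAbove_ne j k')
    · rw [Fin.append_right]
      exact hθw k'
  have hle : Ideal.span (Set.range t) ≤ RingHom.ker θ := by
    rw [Ideal.span_le]
    rintro _ ⟨k, rfl⟩
    exact htθ k
  have hsplit : Ideal.span (Set.range F) = Ideal.span {F 0} ⊔ Ideal.span (Set.range t) := by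
    have : Set.range F = insert (F 0) (Set.range t) := by
      ext z
      constructor
      · rintro ⟨i, rfl⟩
        exact Fin.cases (Or.inl rfl) (fun k => Or.inr ⟨k, rfl⟩) i
      · rintro (rfl | ⟨k, rfl⟩)
        exacts [⟨0, rfl⟩, ⟨k.succ, rfl⟩]
    rw [this, Ideal.span_insert]
  -- `dim L/(t) = 1`, so the prime `(t) ⊆ ker θ ≠ 𝔪_L` is `ker θ`
  haveI hP₀reg : IsRegularLocalRing (L ⧸ Ideal.span (Set.range t)) := ht.isRegularLocalRing_quotient
  have hdimq : ringKrullDim (L ⧸ Ideal.span (Set.range t)) = 1 := by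
    have h1 := ht.ringKrullDim_quotient_add
    have hL' : ringKrullDim L = ((m + l + 1 : ℕ) : WithBot ℕ∞) := by
      rw [← hL, hdimL]
    obtain ⟨k, hk⟩ := exists_nat_cast_eq_ringKrullDim (R := L ⧸ Ideal.span (Set.range t))
    rw [hk, hL'] at h1
    rw [hk]
    have : k + (m + l) = m + l + 1 := by exact_mod_cast h1
    have hk1 : k = 1 := by omega
    rw [hk1]
    rfl
  have heq : Ideal.span (Set.range t) = RingHom.ker θ := by
    haveI := isDomain_of_isRegularLocalRing (L ⧸ Ideal.span (Set.range t))
    haveI : IsPrincipalIdealRing (L ⧸ Ideal.span (Set.range t)) :=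
      isPrincipalIdealRing_of_ringKrullDim_le_one hdimq.le
    haveI : (RingHom.ker θ).IsPrime := RingHom.ker_isPrime θ
    by_contra hne
    set P₀ := Ideal.span (Set.range t) with hP₀
    set 𝔨 : Ideal (L ⧸ P₀) := (RingHom.ker θ).map (Ideal.Quotient.mk P₀) with h𝔨def
    haveI h𝔨 : 𝔨.IsPrime :=
      Ideal.map_isPrime_of_surjective Ideal.Quotient.mk_surjective (by rw [Ideal.mk_ker]; exact hle)
    have h𝔨0 : 𝔨 ≠ ⊥ := by
      intro h
      rw [h𝔨def, Ideal.map_eq_bot_iff_le_ker, Ideal.mk_ker] at h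
      exact hne (le_antisymm hle h)
    have h𝔨max : 𝔨.IsMaximal := IsPrime.to_maximal_ideal h𝔨0
    have h𝔨eq : 𝔨 = maximalIdeal _ := IsLocalRing.eq_maximalIdeal h𝔨max
    have hcomap : 𝔨.comap (Ideal.Quotient.mk P₀) = RingHom.ker θ := by
      rw [h𝔨def, Ideal.comap_map_of_surjective _ Ideal.Quotient.mk_surjective,
        ← RingHom.ker_eq_comap_bot, Ideal.mk_ker, sup_eq_left.mpr hle]
    have hcomap' : (maximalIdeal (L ⧸ P₀)).comap (Ideal.Quotient.mk P₀) = maximalIdeal L := by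
      rw [maximalIdeal_quotient_eq_map P₀,
        Ideal.comap_map_of_surjective _ Ideal.Quotient.mk_surjective, ← RingHom.ker_eq_comap_bot,
        Ideal.mk_ker, sup_eq_left]
      exact hP₀ ▸ ht.span_range_le_maximalIdeal
    have hkerm : RingHom.ker θ = maximalIdeal L := by rw [← hcomap, h𝔨eq, hcomap']
    apply hθj
    rw [← hF0, ← RingHom.mem_ker, hkerm]
    exact hfam.mem_maximalIdeal 0
  refine ⟨t, ht, heq, ?_⟩
  rw [← heq, ← hF0, sup_comm, ← hsplit, hspanF]


end Literature.AlgebraicGeometry.Resolution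

end
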